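import Literature.NumberTheory.EllipticCurves.PAdicPowerSeriesCharacterEvaluationProofs
import Literature.NumberTheory.EllipticCurves.CyclotomicInterpolantUniquenessProofs
import Literature.NumberTheory.EllipticCurves.IwasawaAlgebraRankOneIdealProofs
import HarnessLib

/-!
# Two zeta lines in a rank-one Iwasawa cohomology agree at every height-one prime away from `p` as
# soon as their character values are proportional — Kato 2004, Thm. 12.4 (2) + Thm. 12.5 (1)(2) +
# 13.5 (2) (Rohrlich) + Weierstrass preparation, PROVED as module theory over `Λ = ℤ_p⟦T⟧`

K. Kato, *`p`-adic Hodge theory and values of zeta functions of modular forms*, Astérisque **295**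
(2004) [Kato2004Asterisque]: Thm. 12.4 (2) (p. 221) "`𝐇¹(T)` is a torsion free `Λ`-module, and
`𝐇¹(T) ⊗ ℚ = 𝐇¹(V_{F_λ}(f))` is a free `Λ ⊗ ℚ`-module of rank `1`"; Thm. 12.5 (1) (p. 221) (the
`ψ`-components of the dual exponential of a `Λ`-adic class at the layers of the cyclotomic tower are
`L`-values times a period, for every character `ψ` of `p`-power conductor) and (2) (`𝐇¹(V)/Z(f)` is
`Λ ⊗ ℚ`-torsion); 13.5 (2) (p. 227, Rohrlich [Ro2]) "Assume `k` is even. Let `S` be a finite set of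
prime numbers. Then the set `{χ ∈ ⋃_{prime(m) ⊂ S} Hom((ℤ/m)^×, ℂ^×) ; L_S(f, χ, k/2) = 0}` is finite"
(ARBITRARY finite `S`, the primes of the level included).

THE SITUATION (cell `bsd-2adic`, rung K4 of `BirchSwinnertonDyer`, crux stmt-BirchSwinnertonDyer-19098
`AdditiveRankZeroAtTwo`, seat `bsd-2adic-addL2x` GEN 19; reading step **T22 (b)** of the four descent
sockets `…Theorems.AddKatoTwo.KatoDescentSocketAtTwoAdditiveNeg{One,Two}SplitTwist{,Reducible}`, memo
`run/shared/lean/pub/bsd-2adic/addL2x/gen18/NOTE-T22-descent-socket-GEN18.md` §2). In Kato's rank-one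
module `𝐇'¹ = 𝐇¹_Γ(T₂W)` of an additive curve `W` one has TWO zeta lines: Kato's own `Z = Λ·z`,
`z = z_γ(f_W)` (13.9), and the line `Z̃ = Λ·z̃` transported from the split-multiplicative twist
`W' = W^{(−1)}` along the odd branch of Kato's tower (the cell's construction fact
`Kato2004.exists_splitTwistDivisibilityInputsDescent_negOne_two`). The descent T1–T14 needs `Z`, the
Iwasawa-level input (IW_d) is about `Z̃`; T22 (b) says they generate the same line at every height-one
prime `𝔮 ∌ 2`. The printed inputs are: rank one (12.4 (2)), the character values of both classes
(12.5 (1) for `f_W` at `ψ` and for `f_{W'}` at `ωψ`, with `L(f_{W'}, ωψ, s) = L(f_W, ψ, s)`), their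
non-vanishing for all but finitely many `ψ` (13.5 (2)), and `p`-adic Weierstrass preparation
(Washington §7.1). THIS FILE proves the deduction as pure algebra + `p`-adic analysis, with Kato's
objects as VARIABLES (nothing about them is defined or asserted; the identification of `H, z, z̃, v`
with `𝐇¹_Γ(T₂W)`, the two classes and the `ψ`-components of `exp*` is the business of the reader):

* §1 (any commutative ring `R`) `Module.lengthAt_quotient_span_singleton_eq_of_smul_eq_smul`: if
  `a • z' = b • z` with `a, b ∉ 𝔮` then `ℓ_𝔮(M/Rz') = ℓ_𝔮(M/Rz)` — the two cyclic submodules have the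
  same localisation at `𝔮`.
* §2 (a domain `R`) in a torsion-free module of rank `≤ 1` two elements are proportional,
  `a • z' = b • z` with `a ≠ 0` (the tree's `Module.exists_smul_eq_smul_of_rank_le_one`,
  `IwasawaAlgebraRankOneIdealProofs`) and `b ≠ 0` if `z' ≠ 0` (`Module.ne_zero_of_smul_eq_smul`) — the
  algebra of Thm. 12.4 (2); over `Λ = IwasawaAlgebra p`, a relation with CONSTANT coefficients
  `C c₁ • z' = C c₂ • z` (`c₁ c₂ ∈ ℤ_p ∖ 0`) gives equal lengths at every height-one `𝔮 ∌ p`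
  (`IwasawaAlgebra.lengthAt_quotient_span_singleton_eq_of_C_smul_eq_C_smul`).
* §3 (`p`-adic analysis in `ℂ_p`) `eq_zero_of_bounded_of_forall_character_hasSum_zero_off_finset`: a
  power series with bounded coefficients in `ℂ_p` vanishing at `χ(γ) − 1` for all but finitely many
  primitive characters `χ` of `Γ` is zero (from the tree's all-characters theorem
  `eq_zero_of_bounded_of_forall_character_hasSum_zero` applied to `D · T · ∏ (T − t_j)`); hence
  (`IwasawaAlgebra.exists_C_mul_eq_C_mul_of_values_proportional`) two elements `a, b ∈ Λ` whose
  values at those points are proportional to two fixed non-zero constants of `ℂ_p` satisfy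
  `C c₁ · a = C c₂ · b` with `c₁, c₂ ∈ ℤ_p ∖ 0`.
* §4 THE SKELETON OF T22 (b) `Kato2004.lengthAt_quotient_span_eq_of_characterValues_proportional`:
  `H` a torsion-free `Λ`-module of rank `≤ 1` (12.4 (2)), `z, z̃ ∈ H` non-zero (12.5 (2)), and for
  all but finitely many primitive characters `χ` of `Γ` an additive functional `v_χ : H → ℂ_p` which is
  `Λ`-semilinear through `χ` (`v_χ(a • x) = a(χ(γ) − 1) · v_χ(x)` — the `χ`-component of `exp*` at the
  layer of `χ`), does not vanish on `z` (13.5 (2)) and takes proportional values `α · v_χ(z̃) = β · v_χ(z)`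
  with FIXED non-zero `α, β ∈ ℂ_p` (12.5 (1) twice: one period ratio) ⟹
  `ℓ_𝔮(H/Λz̃) = ℓ_𝔮(H/Λz)` at every height-one prime `𝔮 ∌ p`.

Theorems only; no definition, no named fact (D-0014/D-0026); nothing about elliptic curves is used or
asserted; BSD is not advanced. WHAT IS NOT HERE: the value functionals themselves (Kato 12.5 (1) read
on the pinned `𝐇¹_Γ`), Rohrlich's theorem, anything at the prime `(p)` of `Λ` (the constants `c₁, c₂`
are powers of `p` times units: the two lines differ there in general).

References: [Kato2004Asterisque] Thm. 12.4 (2), Thm. 12.5 (1)(2) (pp. 221–222), 13.5 (2) (p. 227), 13.9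
(pp. 229–230); [Washington1997] §7.1 (Weierstrass preparation), §13.2; [MazurTateTeitelbaum1986Invent]
§I.12–I.14; [Rohrlich1988MathAnn] Theorem (= Kato 13.5 (2)); [Lang1990] Ch. 5 §2 Thm. 2.2.
-/

noncomputable section

open scoped Classical

namespace Literature.NumberTheory.EllipticCurves

/-! ### §1 Two cyclic submodules with unit-proportional generators have the same local length -/

namespace Module

variable {R : Type*} [CommRing R] {M : Type*} [AddCommGroup M] [_root_.Module R M]

/-- If `b • z ∈ R∙z'` with `b ∉ 𝔮`, then `M/Rz'` and `M/(Rz' + Rz)` have the same local length at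
`𝔮`: the kernel of `M/Rz' ↠ M/(Rz' + Rz)` is generated by the class of `z`, which is killed by `b`,
hence dies after localisation at `𝔮` (Bourbaki AC II §2.4; NSW (5.1.4) Remark 1: a module killed by an
element outside `𝔮` has trivial localisation at `𝔮`). [cite: NeukirchSchmidtWingberg2008, Ch. V §1, (5.1.4) Remark 1] -/
theorem lengthAt_quotient_span_singleton_eq_sup_of_smul_mem {z z' : M} {b : R}
    (hb : b • z ∈ Submodule.span R {z'}) (𝔮 : PrimeSpectrum R) (hb𝔮 : b ∉ 𝔮.asIdeal) :
    lengthAt R (M ⧸ Submodule.span R {z'}) 𝔮 =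
      lengthAt R (M ⧸ (Submodule.span R {z'} ⊔ Submodule.span R {z})) 𝔮 := by
  set P : Submodule R M := Submodule.span R {z'} with hP
  set N : Submodule R M := Submodule.span R {z'} ⊔ Submodule.span R {z} with hN
  have hPN : P ≤ N := le_sup_left
  -- `ℓ(M/P) = ℓ(N/P) + ℓ((M/P)/(N/P))` and `(M/P)/(N/P) ≃ M/N`
  rw [lengthAt_eq_add_quotient (N.map P.mkQ) 𝔮,
    lengthAt_eq_of_linearEquiv (Submodule.quotientQuotientEquivQuotient P N hPN) 𝔮]
  -- `N/P` is generated by the class of `z`, killed by `b ∉ 𝔮`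
  have htors : _root_.Module.IsTorsionBy R (N.map P.mkQ) b := by
    intro x
    obtain ⟨x, hx⟩ := x
    rw [SetLike.mk_smul_mk, Submodule.mk_eq_zero]
    have hle : N.map P.mkQ ≤ Submodule.torsionBy R (M ⧸ P) b := by
      rw [hN, Submodule.map_sup, Submodule.map_span, Submodule.map_span, Set.image_singleton,
        Set.image_singleton, sup_le_iff, Submodule.span_le, Submodule.span_le,
        Set.singleton_subset_iff, Set.singleton_subset_iff]
      refine ⟨?_, ?_⟩
      · simp only [SetLike.mem_coe, Submodule.mem_torsionBy_iff, Submodule.mkQ_apply]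
        rw [(Submodule.Quotient.mk_eq_zero P).mpr (Submodule.mem_span_singleton_self z'), smul_zero]
      · simp only [SetLike.mem_coe, Submodule.mem_torsionBy_iff, Submodule.mkQ_apply]
        rw [← Submodule.Quotient.mk_smul, Submodule.Quotient.mk_eq_zero]
        exact hb
    exact (Submodule.mem_torsionBy_iff b x).mp (hle hx)
  rw [lengthAt_eq_zero_of_isTorsionBy htors 𝔮 hb𝔮, zero_add]

/-- **Unit-proportional generators give cyclic submodules of the same local length.** If
`a • z' = b • z` in an `R`-module `M` with `a ∉ 𝔮` and `b ∉ 𝔮` (`𝔮` a prime of `R`), then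
`ℓ_𝔮(M/Rz') = ℓ_𝔮(M/Rz)`: both equal `ℓ_𝔮(M/(Rz' + Rz))`, since `(Rz')_𝔮 = (Rz)_𝔮` in `M_𝔮`.
This is the algebra behind "the two zeta lines agree at `𝔮`" (Kato 2004, proof of Thm. 12.6 /
§13.12: sub-`Λ`-modules of the rank-one `𝐇¹` differing by a unit at `𝔮` have the same quotient
length there). [cite: Kato2004Asterisque, Thm. 12.4 (2) and Thm. 12.6 (pp. 221–222)] -/
theorem lengthAt_quotient_span_singleton_eq_of_smul_eq_smul {z z' : M} {a b : R}
    (hab : a • z' = b • z) (𝔮 : PrimeSpectrum R) (ha𝔮 : a ∉ 𝔮.asIdeal) (hb𝔮 : b ∉ 𝔮.asIdeal) :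
    lengthAt R (M ⧸ Submodule.span R {z'}) 𝔮 = lengthAt R (M ⧸ Submodule.span R {z}) 𝔮 := by
  have h₁ : b • z ∈ Submodule.span R {z'} := by
    rw [← hab]; exact Submodule.smul_mem _ _ (Submodule.mem_span_singleton_self z')
  have h₂ : a • z' ∈ Submodule.span R {z} := by
    rw [hab]; exact Submodule.smul_mem _ _ (Submodule.mem_span_singleton_self z)
  rw [lengthAt_quotient_span_singleton_eq_sup_of_smul_mem h₁ 𝔮 hb𝔮,
    lengthAt_quotient_span_singleton_eq_sup_of_smul_mem h₂ 𝔮 ha𝔮, sup_comm]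

/-! ### §2 Rank one: any two elements of a torsion-free module of rank `≤ 1` are proportional -/

/-- **Thm. 12.4 (2) as algebra, the second coefficient.** In a torsion-free module over a domain, a
relation `a • z' = b • z` with `a ≠ 0` (as supplied by the tree's
`Module.exists_smul_eq_smul_of_rank_le_one` in rank `≤ 1`) has `b ≠ 0` as soon as `z' ≠ 0`
("`𝐇¹(T)` is a torsion free `Λ`-module"). [cite: Kato2004Asterisque, Thm. 12.4 (2) (p. 221)] -/
theorem ne_zero_of_smul_eq_smul [IsDomain R] [_root_.Module.IsTorsionFree R M] {z z' : M}
    {a b : R} (hab : a • z' = b • z) (ha : a ≠ 0) (hz' : z' ≠ 0) : b ≠ 0 := by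
  rintro rfl
  rw [zero_smul] at hab
  exact hz' ((smul_eq_zero_iff_right ha).mp hab)

/-- In a torsion-free module over a domain, a relation `a • z' = b • z` together with a relation
`c₁ * a = c₂ * b` between the coefficients (`b ≠ 0`) transfers to `c₂ • z' = c₁ • z`:
`b • (c₂ • z' − c₁ • z) = c₁ • (a • z') − c₁ • (b • z) = 0`. Used to replace the Weierstrass
coefficients `a, b ∈ Λ` by the CONSTANTS `c₁, c₂` found from the character values (§3) — the algebra of
"`𝐇¹(T)` is a torsion free `Λ`-module" in Thm. 12.4 (2). [cite: Kato2004Asterisque, Thm. 12.4 (2) (p. 221)] -/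
theorem smul_eq_smul_of_mul_eq_mul [IsDomain R] [_root_.Module.IsTorsionFree R M] {z z' : M}
    {a b c₁ c₂ : R} (hab : a • z' = b • z) (hb : b ≠ 0) (hc : c₁ * a = c₂ * b) :
    c₂ • z' = c₁ • z := by
  have h : b • (c₂ • z') = b • (c₁ • z) := by
    calc b • (c₂ • z') = (c₂ * b) • z' := by rw [smul_smul, mul_comm]
      _ = (c₁ * a) • z' := by rw [hc]
      _ = c₁ • (a • z') := by rw [← smul_smul]
      _ = c₁ • (b • z) := by rw [hab]
      _ = b • (c₁ • z) := by rw [smul_smul, smul_smul, mul_comm]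
  exact (smul_right_inj hb).mp h

end Module

/-! ### §2′ Over `Λ = ℤ_p⟦T⟧`: constants are units at every height-one prime `𝔮 ∌ p` -/

namespace IwasawaAlgebra

variable {p : ℕ} [Fact p.Prime]

/-- A non-zero constant `C c`, `c ∈ ℤ_p`, lies in no prime `𝔮` of `Λ = ℤ_p⟦T⟧` with `p ∉ 𝔮`:
`c = u·p^k` with `u ∈ ℤ_p^×`, so `C c = (C u)·(C p)^k` with `C u` a unit (Washington §13.2: the
only height-one prime containing a constant is `(p)`). [cite: Washington1997, §13.2] -/
theorem C_not_mem_of_ne_zero {c : ℤ_[p]} (hc : c ≠ 0) (𝔮 : PrimeSpectrum (IwasawaAlgebra p))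
    (hp𝔮 : PowerSeries.C (p : ℤ_[p]) ∉ 𝔮.asIdeal) : PowerSeries.C c ∉ 𝔮.asIdeal := by
  intro hmem
  have hfac : c = (PadicInt.unitCoeff hc : ℤ_[p]) * (p : ℤ_[p]) ^ c.valuation :=
    PadicInt.unitCoeff_spec hc
  rw [hfac, map_mul, map_pow] at hmem
  rcases 𝔮.isPrime.mem_or_mem hmem with h | h
  · exact 𝔮.isPrime.ne_top
      (Ideal.eq_top_of_isUnit_mem _ h ((Units.isUnit _).map (PowerSeries.C (R := ℤ_[p]))))
  · exact hp𝔮 (𝔮.isPrime.mem_of_pow_mem _ h)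

/-- **Two elements related by non-zero CONSTANTS generate the same line away from `p`.** If
`C c₁ • z' = C c₂ • z` in a `Λ`-module `M` with `c₁, c₂ ∈ ℤ_p ∖ 0`, then
`ℓ_𝔮(M/Λz') = ℓ_𝔮(M/Λz)` at every prime `𝔮 ∌ p` of `Λ` (§1 with
`IwasawaAlgebra.C_not_mem_of_ne_zero`). For Kato's two zeta lines this is the conclusion of reading
step T22 (b): the period ratio `c = c₂/c₁ ∈ ℚ_p^×` is invisible at every height-one `𝔮 ∌ p`.
[cite: Kato2004Asterisque, Thm. 12.6 (p. 222)] [cite: Washington1997, §13.2] -/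
theorem lengthAt_quotient_span_singleton_eq_of_C_smul_eq_C_smul {M : Type*} [AddCommGroup M]
    [Module (IwasawaAlgebra p) M] {z z' : M} {c₁ c₂ : ℤ_[p]} (hc₁ : c₁ ≠ 0) (hc₂ : c₂ ≠ 0)
    (h : PowerSeries.C c₁ • z' = PowerSeries.C c₂ • z) (𝔮 : PrimeSpectrum (IwasawaAlgebra p))
    (hp𝔮 : PowerSeries.C (p : ℤ_[p]) ∉ 𝔮.asIdeal) :
    Module.lengthAt (IwasawaAlgebra p) (M ⧸ Submodule.span (IwasawaAlgebra p) {z'}) 𝔮 =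
      Module.lengthAt (IwasawaAlgebra p) (M ⧸ Submodule.span (IwasawaAlgebra p) {z}) 𝔮 :=
  Module.lengthAt_quotient_span_singleton_eq_of_smul_eq_smul h 𝔮 (C_not_mem_of_ne_zero hc₁ 𝔮 hp𝔮)
    (C_not_mem_of_ne_zero hc₂ 𝔮 hp𝔮)

end IwasawaAlgebra

/-! ### §3 `p`-adic analysis: a bounded series vanishing at all but finitely many character points
is zero; two elements of `Λ` with proportional character values are proportional by constants -/

section Analysis

open PowerSeries in
/-- Boundedness of coefficients is preserved by multiplication by `X` (a shift). [folklore] -/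
private theorem bdd_mul_X {p : ℕ} [Fact p.Prime] {F : PowerSeries ℂ_[p]} {C : ℝ}
    (hF : ∀ i, ‖coeff i F‖ ≤ C) : ∀ i, ‖coeff i (F * X)‖ ≤ C := by
  intro i
  cases i with
  | zero => rw [coeff_zero_mul_X, norm_zero]; exact (norm_nonneg _).trans (hF 0)
  | succ n => rw [coeff_succ_mul_X]; exact hF n

open PowerSeries in
/-- Boundedness of coefficients is preserved by multiplication by a linear factor `X − C s`
(bound `C + C‖s‖`). [folklore] -/
private theorem bdd_mul_X_sub_C {p : ℕ} [Fact p.Prime] {F : PowerSeries ℂ_[p]} {C : ℝ}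
    (hF : ∀ i, ‖coeff i F‖ ≤ C) (s : ℂ_[p]) :
    ∀ i, ‖coeff i (F * (X - PowerSeries.C s))‖ ≤ C + C * ‖s‖ := by
  intro i
  rw [mul_sub, map_sub]
  refine (norm_sub_le _ _).trans (add_le_add (bdd_mul_X hF i) ?_)
  rw [mul_comm F, coeff_C_mul, norm_mul, mul_comm]
  exact mul_le_mul_of_nonneg_right (hF i) (norm_nonneg _)

open PowerSeries in
/-- Boundedness of coefficients is preserved by multiplication by a finite product of linear
factors `∏_{s ∈ S} (X − C s)`. [folklore] -/
private theorem bdd_mul_prod_X_sub_C {p : ℕ} [Fact p.Prime] (S : Finset ℂ_[p]) :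
    ∀ {F : PowerSeries ℂ_[p]} {C : ℝ}, (∀ i, ‖coeff i F‖ ≤ C) →
      ∃ C' : ℝ, ∀ i, ‖coeff i (F * ∏ s ∈ S, (X - PowerSeries.C s))‖ ≤ C' := by
  induction S using Finset.induction_on with
  | empty => intro F C hF; exact ⟨C, fun i ↦ by rw [Finset.prod_empty, mul_one]; exact hF i⟩
  | insert a S haS ih =>
    intro F C hF
    obtain ⟨C', hC'⟩ := ih (bdd_mul_X_sub_C hF a)
    exact ⟨C', fun i ↦ by rw [Finset.prod_insert haS, ← mul_assoc]; exact hC' i⟩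

/-- The value of the linear factor `X − C s` at `t` is `t − s` (polynomial evaluation). [folklore] -/
private theorem hasSum_coeff_X_sub_C_mul_pow {p : ℕ} [Fact p.Prime] (s t : ℂ_[p]) :
    HasSum (fun k ↦ PowerSeries.coeff k (PowerSeries.X - PowerSeries.C s : PowerSeries ℂ_[p]) * t ^ k)
      (t - s) := by
  have h := hasSum_map_coeff_coe_mul_pow (RingHom.id ℂ_[p]) (Polynomial.X - Polynomial.C s) t
  rw [Polynomial.eval₂_sub, Polynomial.eval₂_X, Polynomial.eval₂_C, RingHom.id_apply] at h
  refine h.congr_fun fun k ↦ ?_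
  rw [RingHom.id_apply, Polynomial.coe_sub, Polynomial.coe_X, Polynomial.coe_C]

/-- **A power series with bounded coefficients in `ℂ_p` vanishing at `χ(γ) − 1` for ALL BUT FINITELY
MANY primitive characters `χ` of `Γ` is zero** (exceptional points collected in a finite set `S`).
Multiply `D` by `T · ∏_{t ∈ S} (T − t)`: the product is bounded, has constant term `0` and vanishes at
EVERY `χ(γ) − 1` (evaluation on the open disc is multiplicative, `tsum_map_coeff_mul_mul_pow`), so the
tree's all-characters theorem `eq_zero_of_bounded_of_forall_character_hasSum_zero` kills it, and
`ℂ_p⟦T⟧` is a domain. This is the form in which Rohrlich's theorem (Kato 13.5 (2): all but finitely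
many character values are non-zero) meets the uniqueness principle of Mazur–Tate–Teitelbaum §I.12–I.14.
[cite: MazurTateTeitelbaum1986Invent, §I.12–I.14] [cite: Kato2004Asterisque, 13.5 (2) (p. 227)] -/
theorem eq_zero_of_bounded_of_forall_character_hasSum_zero_off_finset {p : ℕ} [Fact p.Prime]
    {D : PowerSeries ℂ_[p]} {C : ℝ} (hD : ∀ i, ‖PowerSeries.coeff i D‖ ≤ C) (S : Finset ℂ_[p])
    (h : ∀ m : ℕ, 0 < m → ∀ χ : DirichletCharacter ℂ_[p] (p ^ m), χ.IsPrimitive → χ.Even →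
      (∃ j : ℕ, orderOf χ = p ^ j) → (χ (cyclotomicGenerator p : ZMod (p ^ m)) - 1) ∉ S →
        HasSum (fun i ↦ PowerSeries.coeff i D *
          (χ (cyclotomicGenerator p : ZMod (p ^ m)) - 1) ^ i) 0) :
    D = 0 := by
  set Q : PowerSeries ℂ_[p] := ∏ s ∈ S, (PowerSeries.X - PowerSeries.C s) with hQ
  set G : PowerSeries ℂ_[p] := D * PowerSeries.X * Q with hG
  -- `G` is bounded
  obtain ⟨C', hC'⟩ := bdd_mul_prod_X_sub_C S (bdd_mul_X hD)
  have hGb : ∀ i, ‖(RingHom.id ℂ_[p]) (PowerSeries.coeff i G)‖ ≤ C' := fun i ↦ hC' i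
  -- constant term `0`
  have hG0 : PowerSeries.constantCoeff G = 0 := by
    rw [hG, map_mul, map_mul, PowerSeries.constantCoeff_X, mul_zero, zero_mul]
  -- the value of a product at a point of the open disc
  have hid : ∀ (A : PowerSeries ℂ_[p]) (k : ℕ),
      (RingHom.id ℂ_[p]) (PowerSeries.coeff k A) = PowerSeries.coeff k A := fun _ _ ↦ rfl
  have hGz : G = 0 := by
    refine eq_zero_of_bounded_of_forall_character_hasSum_zero (RingHom.id ℂ_[p])
      Function.injective_id hGb hG0 fun m hm χ hχp hχe hχo ↦ ?_
    set t : ℂ_[p] := χ (cyclotomicGenerator p : ZMod (p ^ m)) - 1 with ht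
    have htn : ‖t‖ < 1 := norm_apply_cyclotomicGenerator_sub_one_lt χ hχo
    simp only [hid]
    -- `G` is summable at `t`; it suffices to compute the sum
    have hGs : Summable fun i ↦ PowerSeries.coeff i G * t ^ i := by
      have := summable_map_coeff_mul_pow (RingHom.id ℂ_[p]) hGb htn
      simpa only [hid] using this
    suffices hval : ∑' i, PowerSeries.coeff i G * t ^ i = 0 by rw [← hval]; exact hGs.hasSum
    by_cases htS : t ∈ S
    · -- `t ∈ S`: the factor `X − C t` vanishes at `t`
      have hQ' : G = (D * PowerSeries.X * ∏ s ∈ S.erase t, (PowerSeries.X - PowerSeries.C s)) *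
          (PowerSeries.X - PowerSeries.C t) := by
        rw [hG, hQ, ← Finset.prod_erase_mul S _ htS, mul_assoc (D * PowerSeries.X)]
      obtain ⟨C₁, hC₁⟩ := bdd_mul_prod_X_sub_C (S.erase t) (bdd_mul_X hD)
      have hlin : ∀ i, ‖(RingHom.id ℂ_[p]) (PowerSeries.coeff i
          (PowerSeries.X - PowerSeries.C t : PowerSeries ℂ_[p]))‖ ≤ 1 + 1 * ‖t‖ := by
        have h1 : ∀ i, ‖PowerSeries.coeff i (1 : PowerSeries ℂ_[p])‖ ≤ 1 := fun i ↦ by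
          rw [PowerSeries.coeff_one]; split_ifs <;> simp
        intro i; rw [hid, ← one_mul (PowerSeries.X - PowerSeries.C t)]; exact bdd_mul_X_sub_C h1 t i
      have hmul := tsum_map_coeff_mul_mul_pow (RingHom.id ℂ_[p])
        (A := D * PowerSeries.X * ∏ s ∈ S.erase t, (PowerSeries.X - PowerSeries.C s))
        (B := PowerSeries.X - PowerSeries.C t) (fun i ↦ hC₁ i) hlin htn
      have hlinval := (hasSum_coeff_X_sub_C_mul_pow t t).tsum_eq
      simp only [hid] at hmul
      rw [hQ', hmul, hlinval, sub_self, mul_zero]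
    · -- `t ∉ S`: `D` vanishes at `t`
      have hDX : ∀ i, ‖(RingHom.id ℂ_[p]) (PowerSeries.coeff i (D * PowerSeries.X))‖ ≤ C :=
        fun i ↦ bdd_mul_X hD i
      have hQb : ∃ C₂ : ℝ, ∀ i, ‖(RingHom.id ℂ_[p]) (PowerSeries.coeff i Q)‖ ≤ C₂ := by
        have h1 : ∀ i, ‖PowerSeries.coeff i (1 : PowerSeries ℂ_[p])‖ ≤ 1 := fun i ↦ by
          rw [PowerSeries.coeff_one]; split_ifs <;> simp
        obtain ⟨C₂, hC₂⟩ := bdd_mul_prod_X_sub_C S h1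
        exact ⟨C₂, fun i ↦ by rw [hid, hQ, ← one_mul (∏ s ∈ S, _)]; exact hC₂ i⟩
      obtain ⟨C₂, hC₂⟩ := hQb
      have hD' : ∀ i, ‖(RingHom.id ℂ_[p]) (PowerSeries.coeff i D)‖ ≤ C := fun i ↦ hD i
      have hX : ∀ i, ‖(RingHom.id ℂ_[p]) (PowerSeries.coeff i (PowerSeries.X : PowerSeries ℂ_[p]))‖
          ≤ 1 := by
        have h1 : ∀ i, ‖PowerSeries.coeff i (1 : PowerSeries ℂ_[p])‖ ≤ 1 := fun i ↦ by
          rw [PowerSeries.coeff_one]; split_ifs <;> simp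
        intro i; rw [hid, ← one_mul PowerSeries.X]; exact bdd_mul_X h1 i
      have hm1 := tsum_map_coeff_mul_mul_pow (RingHom.id ℂ_[p]) (A := D * PowerSeries.X) (B := Q)
        hDX hC₂ htn
      have hm2 := tsum_map_coeff_mul_mul_pow (RingHom.id ℂ_[p]) (A := D) (B := PowerSeries.X)
        hD' hX htn
      have hDval := (h m hm χ hχp hχe hχo htS).tsum_eq
      simp only [hid] at hm1 hm2
      rw [hG, hm1, hm2, hDval, zero_mul, zero_mul]
  -- cancel the non-zero polynomial factors in the domain `ℂ_p⟦T⟧`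
  have hQne : Q ≠ 0 := by
    rw [hQ]
    refine Finset.prod_ne_zero_iff.mpr fun s _ ↦ ?_
    rw [← Polynomial.coe_X, ← Polynomial.coe_C, ← Polynomial.coe_sub, Ne, Polynomial.coe_eq_zero_iff]
    exact Polynomial.X_sub_C_ne_zero s
  rw [hG] at hGz
  rcases mul_eq_zero.mp hGz with h1 | h1
  · rcases mul_eq_zero.mp h1 with h2 | h2
    · exact h2
    · exact absurd h2 PowerSeries.X_ne_zero
  · exact absurd h1 hQne

variable {p : ℕ} [Fact p.Prime]

/-- The embedding `ℤ_p ↪ ℂ_p` used to evaluate elements of `Λ` on the open unit disc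
(notation-free abbreviation inside proofs: `(algebraMap ℚ_[p] ℂ_[p]).comp (algebraMap ℤ_[p] ℚ_[p])`).
Injective. [folklore] -/
private theorem injective_algebraMap_padicInt_padicComplex :
    Function.Injective ((algebraMap ℚ_[p] ℂ_[p]).comp (algebraMap ℤ_[p] ℚ_[p])) :=
  (algebraMap ℚ_[p] ℂ_[p]).injective.comp (IsFractionRing.injective ℤ_[p] ℚ_[p])

/-- **Two elements of `Λ = ℤ_p⟦T⟧` with proportional values at all but finitely many character points
are proportional by non-zero CONSTANTS.** Let `a, b ∈ Λ`, `a ≠ 0`, `α, β ∈ ℂ_p ∖ 0`, and suppose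
`β · a(χ(γ) − 1) = α · b(χ(γ) − 1)` for every primitive character `χ` of `Γ` with `χ(γ) − 1` outside a
finite set (`a(t) = ∑ a_i t^i` in `ℂ_p`). Then `C c₁ · a = C c₂ · b` for some `c₁, c₂ ∈ ℤ_p ∖ 0`:
`D = β·a − α·b ∈ ℂ_p⟦T⟧` is bounded and vanishes at those points, so `D = 0`
(`eq_zero_of_bounded_of_forall_character_hasSum_zero_off_finset`), i.e. `β a_i = α b_i` for all `i`;
with `a_{i₀} ≠ 0` one gets `b_{i₀} ≠ 0` and `b_{i₀}·a = a_{i₀}·b` coefficientwise. The constants are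
what survives of the two PERIODS `α, β` — the ratio `α/β = a_{i₀}/b_{i₀}` is automatically in `ℚ_p`.
[cite: MazurTateTeitelbaum1986Invent, §I.12–I.14] [cite: Washington1997, §7.1] -/
theorem IwasawaAlgebra.exists_C_mul_eq_C_mul_of_values_proportional {a b : IwasawaAlgebra p}
    (ha : a ≠ 0) {α β : ℂ_[p]} (hα : α ≠ 0) (hβ : β ≠ 0) (S : Finset ℂ_[p])
    (h : ∀ m : ℕ, 0 < m → ∀ χ : DirichletCharacter ℂ_[p] (p ^ m), χ.IsPrimitive → χ.Even →
      (∃ j : ℕ, orderOf χ = p ^ j) → (χ (cyclotomicGenerator p : ZMod (p ^ m)) - 1) ∉ S →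
        β * ∑' i, ((algebraMap ℚ_[p] ℂ_[p]).comp (algebraMap ℤ_[p] ℚ_[p])) (PowerSeries.coeff i a) *
            (χ (cyclotomicGenerator p : ZMod (p ^ m)) - 1) ^ i =
          α * ∑' i, ((algebraMap ℚ_[p] ℂ_[p]).comp (algebraMap ℤ_[p] ℚ_[p])) (PowerSeries.coeff i b) *
            (χ (cyclotomicGenerator p : ZMod (p ^ m)) - 1) ^ i) :
    ∃ c₁ c₂ : ℤ_[p], c₁ ≠ 0 ∧ c₂ ≠ 0 ∧ PowerSeries.C c₁ * a = PowerSeries.C c₂ * b := by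
  set ι : ℤ_[p] →+* ℂ_[p] := (algebraMap ℚ_[p] ℂ_[p]).comp (algebraMap ℤ_[p] ℚ_[p]) with hι
  have hιinj : Function.Injective ι := injective_algebraMap_padicInt_padicComplex
  have hbd : ∀ (A : IwasawaAlgebra p) (k : ℕ), ‖ι (PowerSeries.coeff k A)‖ ≤ 1 :=
    norm_algebraMap_coeff_le_one
  -- `D = β·a − α·b` over `ℂ_p`
  set D : PowerSeries ℂ_[p] :=
    PowerSeries.C β * PowerSeries.map ι a - PowerSeries.C α * PowerSeries.map ι b with hDdef
  have hDcoeff : ∀ i, PowerSeries.coeff i D = β * ι (PowerSeries.coeff i a) - α * ι (PowerSeries.coeff i b) := by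
    intro i
    rw [hDdef, map_sub, PowerSeries.coeff_C_mul, PowerSeries.coeff_C_mul, PowerSeries.coeff_map,
      PowerSeries.coeff_map]
  have hDb : ∀ i, ‖PowerSeries.coeff i D‖ ≤ ‖β‖ + ‖α‖ := by
    intro i
    rw [hDcoeff]
    refine (norm_sub_le _ _).trans (add_le_add ?_ ?_)
    · rw [norm_mul]; exact mul_le_of_le_one_right (norm_nonneg _) (hbd a i)
    · rw [norm_mul]; exact mul_le_of_le_one_right (norm_nonneg _) (hbd b i)
  -- `D` vanishes off `S`
  have hD0 : D = 0 := by
    refine eq_zero_of_bounded_of_forall_character_hasSum_zero_off_finset hDb S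
      fun m hm χ hχp hχe hχo htS ↦ ?_
    set t : ℂ_[p] := χ (cyclotomicGenerator p : ZMod (p ^ m)) - 1 with ht
    have htn : ‖t‖ < 1 := norm_apply_cyclotomicGenerator_sub_one_lt χ hχo
    have hsa := (summable_map_coeff_mul_pow ι (hbd a) htn).hasSum
    have hsb := (summable_map_coeff_mul_pow ι (hbd b) htn).hasSum
    have hlin := (hsa.mul_left β).sub (hsb.mul_left α)
    rw [h m hm χ hχp hχe hχo htS, sub_self] at hlin
    refine hlin.congr_fun fun i ↦ ?_
    rw [hDcoeff]; ring
  -- coefficientwise `β a_i = α b_i`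
  have hcoef : ∀ i, β * ι (PowerSeries.coeff i a) = α * ι (PowerSeries.coeff i b) := by
    intro i
    have := hDcoeff i
    rw [hD0, map_zero] at this
    exact (sub_eq_zero.mp this.symm)
  -- an index with `a_{i₀} ≠ 0`, hence `b_{i₀} ≠ 0`
  obtain ⟨i₀, hi₀⟩ : ∃ i₀, PowerSeries.coeff i₀ a ≠ 0 := by
    by_contra hall
    push Not at hall
    exact ha (PowerSeries.ext fun i ↦ by rw [hall i, map_zero])
  have hb₀ : PowerSeries.coeff i₀ b ≠ 0 := by
    intro hb0
    have := hcoef i₀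
    rw [hb0, map_zero, mul_zero] at this
    rcases mul_eq_zero.mp this with h1 | h1
    · exact hβ h1
    · exact hi₀ (hιinj (by rw [h1, map_zero]))
  refine ⟨PowerSeries.coeff i₀ b, PowerSeries.coeff i₀ a, hb₀, hi₀, PowerSeries.ext fun i ↦ ?_⟩
  rw [PowerSeries.coeff_C_mul, PowerSeries.coeff_C_mul]
  apply hιinj
  rw [map_mul, map_mul]
  -- `b_{i₀} a_i = a_{i₀} b_i` from `β a_i = α b_i`, `β a_{i₀} = α b_{i₀}`, `α β ≠ 0`
  have h1 := hcoef i
  have h2 := hcoef i₀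
  have hαβ : α * β ≠ 0 := mul_ne_zero hα hβ
  apply mul_left_cancel₀ hαβ
  calc α * β * (ι (PowerSeries.coeff i₀ b) * ι (PowerSeries.coeff i a))
      = (α * ι (PowerSeries.coeff i₀ b)) * (β * ι (PowerSeries.coeff i a)) := by ring
    _ = (β * ι (PowerSeries.coeff i₀ a)) * (α * ι (PowerSeries.coeff i b)) := by rw [← h2, h1]
    _ = α * β * (ι (PowerSeries.coeff i₀ a) * ι (PowerSeries.coeff i b)) := by ring

end Analysis

/-! ### §4 The skeleton of reading step T22 (b): two zeta lines with proportional character values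
agree at every height-one prime away from `p` -/

namespace Kato2004

variable {p : ℕ} [Fact p.Prime]

/-- **T22 (b) as a theorem (Kato 2004, Thm. 12.4 (2) + 12.5 (1)(2) + 13.5 (2) + Weierstrass preparation,
module-theoretic skeleton).** Let `H` be a torsion-free `Λ`-module of rank `≤ 1` (Kato's `𝐇¹_Γ(T)`,
Thm. 12.4 (2) — the binders of the tree's `Kato2004.thm12_4`), `z, z̃ ∈ H` non-zero (two `Λ`-adic zeta
classes; 12.5 (2) / 13.9). Suppose that for every primitive character `χ` of `Γ` of `p`-power order,
with `t_χ = χ(γ) − 1` outside a finite exceptional set `S`, there is an additive functional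
`v_χ : H → ℂ_p` (the `χ`-component of the dual exponential at the layer of `χ`, 12.5 (1)) which is
`Λ`-SEMILINEAR through `χ` (`v_χ(a • x) = a(t_χ)·v_χ(x)`), does NOT vanish at `z` (13.5 (2): Rohrlich,
`L(f, χ, 1) ≠ 0` for all but finitely many `χ`), and takes PROPORTIONAL values on the two classes,
`α·v_χ(z̃) = β·v_χ(z)` with FIXED `α, β ∈ ℂ_p ∖ 0` (one period ratio: 12.5 (1) for the two newforms,
`L(f', ωψ, 1) = L(f, ψ, 1)`). Then `ℓ_𝔮(H/Λz̃) = ℓ_𝔮(H/Λz)` at every prime `𝔮 ∌ p` of `Λ` — the two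
zeta lines coincide after localisation at every height-one prime away from `p`. Proof: rank one gives
`a • z̃ = b • z` (`Module.exists_smul_eq_smul_of_rank_le_one`); applying `v_χ`,
`β·a(t_χ) = α·b(t_χ)` off `S`; so `C c₁·a = C c₂·b` with constants `c₁, c₂ ≠ 0`
(`IwasawaAlgebra.exists_C_mul_eq_C_mul_of_values_proportional`); torsion-freeness turns this into
`C c₂ • z̃ = C c₁ • z` (`Module.smul_eq_smul_of_mul_eq_mul`), and constants are units at `𝔮 ∌ p`
(`IwasawaAlgebra.lengthAt_quotient_span_singleton_eq_of_C_smul_eq_C_smul`). Nothing about Kato's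
objects is asserted: `H, z, z̃, v_χ, α, β` are variables; the reader (cell `bsd-2adic`, descent sockets
of crux 19098, step T22 (b)) supplies them from 12.4 (2), 12.5 (1)(2), 13.5 (2).
[cite: Kato2004Asterisque, Thm. 12.4 (2) (p. 221), Thm. 12.5 (1)(2) (pp. 221–222), 13.5 (2) (p. 227), 13.9 (pp. 229–230)]
[cite: MazurTateTeitelbaum1986Invent, §I.12–I.14] [cite: Washington1997, §7.1 and §13.2] -/
theorem lengthAt_quotient_span_eq_of_characterValues_proportional {H : Type*} [AddCommGroup H]
    [Module (IwasawaAlgebra p) H] [Module.IsTorsionFree (IwasawaAlgebra p) H]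
    (hrk : Module.rank (IwasawaAlgebra p) H ≤ 1) {z z' : H} (hz : z ≠ 0) (hz' : z' ≠ 0)
    {α β : ℂ_[p]} (hα : α ≠ 0) (hβ : β ≠ 0) (S : Finset ℂ_[p])
    (hv : ∀ m : ℕ, 0 < m → ∀ χ : DirichletCharacter ℂ_[p] (p ^ m), χ.IsPrimitive → χ.Even →
      (∃ j : ℕ, orderOf χ = p ^ j) → (χ (cyclotomicGenerator p : ZMod (p ^ m)) - 1) ∉ S →
      ∃ v : H →+ ℂ_[p],
        (∀ (a : IwasawaAlgebra p) (x : H), v (a • x) =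
          (∑' i, ((algebraMap ℚ_[p] ℂ_[p]).comp (algebraMap ℤ_[p] ℚ_[p])) (PowerSeries.coeff i a) *
            (χ (cyclotomicGenerator p : ZMod (p ^ m)) - 1) ^ i) * v x) ∧
        v z ≠ 0 ∧ α * v z' = β * v z)
    (𝔮 : PrimeSpectrum (IwasawaAlgebra p)) (hp𝔮 : PowerSeries.C (p : ℤ_[p]) ∉ 𝔮.asIdeal) :
    Module.lengthAt (IwasawaAlgebra p) (H ⧸ Submodule.span (IwasawaAlgebra p) {z'}) 𝔮 =
      Module.lengthAt (IwasawaAlgebra p) (H ⧸ Submodule.span (IwasawaAlgebra p) {z}) 𝔮 := by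
  -- rank one: `a • z' = b • z`, `a, b ≠ 0`
  obtain ⟨a, b, ha, hab⟩ := Module.exists_smul_eq_smul_of_rank_le_one hrk hz z'
  have hb : b ≠ 0 := Module.ne_zero_of_smul_eq_smul hab ha hz'
  -- the character values of `a` and `b` are proportional off `S`
  have hval : ∀ m : ℕ, 0 < m → ∀ χ : DirichletCharacter ℂ_[p] (p ^ m), χ.IsPrimitive → χ.Even →
      (∃ j : ℕ, orderOf χ = p ^ j) → (χ (cyclotomicGenerator p : ZMod (p ^ m)) - 1) ∉ S →
        β * ∑' i, ((algebraMap ℚ_[p] ℂ_[p]).comp (algebraMap ℤ_[p] ℚ_[p])) (PowerSeries.coeff i a) *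
            (χ (cyclotomicGenerator p : ZMod (p ^ m)) - 1) ^ i =
          α * ∑' i, ((algebraMap ℚ_[p] ℂ_[p]).comp (algebraMap ℤ_[p] ℚ_[p])) (PowerSeries.coeff i b) *
            (χ (cyclotomicGenerator p : ZMod (p ^ m)) - 1) ^ i := by
    intro m hm χ hχp hχe hχo htS
    obtain ⟨v, hvlin, hvz, hprop⟩ := hv m hm χ hχp hχe hχo htS
    set A := ∑' i, ((algebraMap ℚ_[p] ℂ_[p]).comp (algebraMap ℤ_[p] ℚ_[p])) (PowerSeries.coeff i a) *
      (χ (cyclotomicGenerator p : ZMod (p ^ m)) - 1) ^ i with hA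
    set B := ∑' i, ((algebraMap ℚ_[p] ℂ_[p]).comp (algebraMap ℤ_[p] ℚ_[p])) (PowerSeries.coeff i b) *
      (χ (cyclotomicGenerator p : ZMod (p ^ m)) - 1) ^ i with hB
    -- `A · v z' = B · v z` from `a • z' = b • z`
    have hAB : A * v z' = B * v z := by rw [← hvlin a z', ← hvlin b z, hab]
    -- `β A v z = α B v z`, then cancel `v z ≠ 0`
    have h1 : (β * A) * v z = (α * B) * v z := by
      calc (β * A) * v z = A * (β * v z) := by ring
        _ = A * (α * v z') := by rw [hprop]
        _ = α * (A * v z') := by ring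
        _ = α * (B * v z) := by rw [hAB]
        _ = (α * B) * v z := by ring
    exact mul_right_cancel₀ hvz h1
  obtain ⟨c₁, c₂, hc₁, hc₂, hc⟩ :=
    IwasawaAlgebra.exists_C_mul_eq_C_mul_of_values_proportional ha hα hβ S hval
  -- constants: `C c₂ • z' = C c₁ • z`
  have hrel : PowerSeries.C c₂ • z' = PowerSeries.C c₁ • z := Module.smul_eq_smul_of_mul_eq_mul hab hb hc
  exact IwasawaAlgebra.lengthAt_quotient_span_singleton_eq_of_C_smul_eq_C_smul hc₂ hc₁ hrel 𝔮 hp𝔮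

end Kato2004

end Literature.NumberTheory.EllipticCurves

end
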